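import Summits.ResolutionOfSingularities.ResolutionOfSingularities.Theorems.MarkedTransferCampaignG1PnegaObligationF33StdNarasimhan
import Summits.ResolutionOfSingularities.ResolutionOfSingularities.Theorems.MarkedTransferCampaignW12SandwichCompletionUnits
import Summits.ResolutionOfSingularities.ResolutionOfSingularities.Theorems.MarkedTransferCampaignW12SandwichFrobeniusConstants
import HarnessLib

/-!
# [OURS · L1 G1 ℘nega-INTERFACE / RESCUE bed-type datum] The Narasimhan `H♭`-datum, PART B: `H♭(ϵ(0)) = x z³`, degree `−2`, every case
# witness is (III); CELLS at the genuine wild datum — SW (class regime `e' = e = 1`, `m = q = 2`) CONTAINS the value at EVERY placement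
# holding the head in degree 2 (✓), PW does not (✗). By res-type-063 (gen 7); PART A = `…F33StdNarasimhan` (objects, datum); carried by
# res-L1-type-o6.

CARRIER NOTE (res-L1-type-o6 g20): KERNEL by res-type-063 (HOME draft `D/res-type-063/PnegaObligationF33StdNarasimhanCells.draft.lean` sha16
c673ef8b3d01ab01, DRAFT READY + CARRY ask 2026-08-27T07:14:45Z, TAKING 07:16Z; PART A carried as p509255), summit-side VERBATIM (this note and
the by-line clause added). [OURS · L1 G1] replaces the role of: nothing printed beyond what the decl docstrings cite — data-level kernels at the
OURS Narasimhan `H♭`-datum (its value, degree and case, and the cells SW ✓ in the class regime at every placement holding the head / PW ✗) for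
the retyped obligation F3.3; NOT a statement of the manuscript.
HONEST FRAMING. Nothing here is a statement of H. Hironaka's manuscript *Resolution of singularities in positive characteristics*
(2017-03-23, [Hironaka2017], lit key `paper:url-3343fd9e678b`; every printed item is a CANDIDATE [claim: Hironaka2017, status:
under-review]). Kernel theorems about OURS objects: the typed `H♭`-datum of PART A (recipe of Rem. 9.11 / Def. 9.12, row 057), the sandwich
family SW (`Campaign.sandwichPNega`, W1.2) and the power witness PW (`Campaign.PowerWitness.tilde`, K13-3). AI kernel work, weaker than
expert review; nothing here is progress on resolution of singularities in positive characteristic; no verdict on any printed statement.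

## What is proved (`K` a field of characteristic 2; `P : ℕ → Ideal K[[y,x,z,w]]` ANY placement with `hg : g ∈ P 2`, `g = y² + xz³ + zw³ + x⁷w`)
* §1 `hasseDeriv_alpha_eps : ∂_x∂_z ϵ(0) = z²`, `hasseDeriv_qgamma_eps : ∂_z^{(2)} ϵ(0) = x z` (`C(3,1) = C(3,2) = 3 ≡ 1`), `pre_eps : h♭(ϵ(0)) = x z³`,
  `pre_val : h♭(x z³) = x z³` (a FIXED POINT of Rem. 9.11 (1)'s preliminary operation), `not_isCaseI`, `not_isCaseII`, `case_eq` (EVERY case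
  witness is (III) — every selection policy evaluates the Case-(III) iterate here), `kBar_eq : k̄ = 2`, **`datum_value : H♭(ϵ(0)) = x z³`**,
  **`datum_degree : −δ(B,III,0) = −2`**, `eps_sub_value : ϵ(0) − H♭(ϵ(0)) = z w³ + x⁷ w` (Eq. (78): the top block leaves in ONE step, `u₀ = 1`).
* §2 CELLS: **`value_mem_sandwichPNega`** — `x z³ ∈ ℘nega_sw(e'=1, P, m=2)(−2)` for EVERY `P ∋ g` in degree 2 (no guard needed): the box
  derivative `Δ_{e_x+e_z}` is a `ρ`-linear sandwich operator of order `2 ≤ 1·m + a` (`W12.exists_sandwichOp_hasseDeriv_powerSeries`, p502133),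
  the head is a live source in `P(1·m)`, `Δ(g) = z²` (`W12.apply_mem_sandwichPNega`), and the pieces are ideals. Hence
  `value_mem_of_sandwich_le`: every family whose degree-`(−2)` piece at `P` contains that sandwich piece MEETS the `F33stdOrd`-shaped demand
  AT THIS DATUM — in contrast with the cylinder toy (`CylDatum.not_F33stdOrd_of_le_sandwich_cylinder`, p506668: ✗ at a Frobenius-split
  placement with a non-new head). **`value_not_mem_powerWitness`** — PW fails here too (`x z³` is off the `2`-lattice, so not a `2^{e'}`-th
  power, `e' ≥ 1`; `PowerWitness.tilde_neg_subset_range_pow`). NO claim that SW meets `F33stdOrd` (all data, all placements).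
-/

noncomputable section

set_option linter.dupNamespace false -- mandated namespace of this single-conjunct summit

namespace Summit.ResolutionOfSingularities.ResolutionOfSingularities.Theorems.Campaign.PnegaObligation.NarasimhanDatum

open Literature.AlgebraicGeometry.Hironaka2017 Literature.AlgebraicGeometry.Hironaka2017.S09LLUED
open Literature.RingTheory.MvPowerSeries (hasseDeriv IsSupportedOnMultiples)
open MvPowerSeries (X monomial coeff)

universe u

variable (K : Type u) [Field K] [CharP K 2]

/-! ## §1 The value `H♭(ϵ(0)) = x z³` and the degree `−2` -/

/-- `(3 : K) = 1` in characteristic `2`. [folklore] -/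
theorem three_eq_one : (3 : K) = 1 := by
  have h : ((3 : ℕ) : K) = 1 := by
    rw [show (3 : ℕ) = 2 + 1 from rfl, Nat.cast_add, CharP.cast_eq_zero K 2, zero_add, Nat.cast_one]
  exact_mod_cast h

/-- **`∂_x∂_z ϵ(0) = z²`** (`Δ_{(0,1,1,0)}`: `x z³ ↦ C(1,1)C(3,1) z² = z²`; `z w³` has no `x`, `x⁷ w` has no `z`). [folklore] -/
theorem hasseDeriv_alpha_eps : hasseDeriv (nu 0 1 1 0) (eps K) = monomial (nu 0 0 2 0) (1 : K) := by
  have hsub : nu 0 1 3 0 - nu 0 1 1 0 = nu 0 0 2 0 := by ext i; fin_cases i <;> simp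
  rw [eps_eq, map_add, map_add, hasseDeriv_monomial_of_le K (nu_le_nu_iff.mpr (by omega)),
    hasseDeriv_monomial_of_not_le K (by rw [nu_le_nu_iff]; omega), hasseDeriv_monomial_of_not_le K (by rw [nu_le_nu_iff]; omega),
    add_zero, add_zero, hsub, Fin.prod_univ_four]
  simp [three_eq_one K]

/-- **`∂_z^{(2)} ϵ(0) = x z`** (`Δ_{(0,0,2,0)}`: `x z³ ↦ C(3,2) x z = x z`; the other two terms have `z`-degree `< 2`). [folklore] -/
theorem hasseDeriv_qgamma_eps : hasseDeriv (nu 0 0 2 0) (eps K) = monomial (nu 0 1 1 0) (1 : K) := by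
  have hsub : nu 0 1 3 0 - nu 0 0 2 0 = nu 0 1 1 0 := by ext i; fin_cases i <;> simp
  rw [eps_eq, map_add, map_add, hasseDeriv_monomial_of_le K (nu_le_nu_iff.mpr (by omega)),
    hasseDeriv_monomial_of_not_le K (by rw [nu_le_nu_iff]; omega), hasseDeriv_monomial_of_not_le K (by rw [nu_le_nu_iff]; omega),
    add_zero, add_zero, hsub, Fin.prod_univ_four]
  simp [three_eq_one K]

/-- `∂_x∂_z (x z³) = z²`. [folklore] -/
theorem hasseDeriv_alpha_val : hasseDeriv (nu 0 1 1 0) (monomial (nu 0 1 3 0) (1 : K)) = monomial (nu 0 0 2 0) (1 : K) := by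
  have hsub : nu 0 1 3 0 - nu 0 1 1 0 = nu 0 0 2 0 := by ext i; fin_cases i <;> simp
  rw [hasseDeriv_monomial_of_le K (nu_le_nu_iff.mpr (by omega)), hsub, Fin.prod_univ_four]
  simp [three_eq_one K]

/-- `∂_z^{(2)} (x z³) = x z`. [folklore] -/
theorem hasseDeriv_qgamma_val : hasseDeriv (nu 0 0 2 0) (monomial (nu 0 1 3 0) (1 : K)) = monomial (nu 0 1 1 0) (1 : K) := by
  have hsub : nu 0 1 3 0 - nu 0 0 2 0 = nu 0 1 1 0 := by ext i; fin_cases i <;> simp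
  rw [hasseDeriv_monomial_of_le K (nu_le_nu_iff.mpr (by omega)), hsub, Fin.prod_univ_four]
  simp [three_eq_one K]

/-- **`h♭(ϵ(0)) = x z³`** (Rem. 9.11 (1): `∂^{(α)}ϵ(0) · ∂^{(qγ₀)}ϵ(0) = z² · x z`). [folklore] -/
theorem pre_eps : HFlat.pre (hasseFamily K 4) 2 2 (nu 0 1 1 0) 0 (nu 0 0 1 0) (eps K) = monomial (nu 0 1 3 0) (1 : K) := by
  have h2 : 2 • nu 0 0 1 0 = nu 0 0 2 0 := by ext i; fin_cases i <;> simp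
  have h4 : nu 0 0 2 0 + nu 0 1 1 0 = nu 0 1 3 0 := by ext i; fin_cases i <;> simp
  unfold HFlat.pre hasseFamily
  rw [smul_zero, add_zero, h2, hasseDeriv_alpha_eps, hasseDeriv_qgamma_eps, MvPowerSeries.monomial_mul_monomial, mul_one, h4]

/-- **`h♭(x z³) = x z³`**: the value is a fixed point of the preliminary operation. [folklore] -/
theorem pre_val : HFlat.pre (hasseFamily K 4) 2 2 (nu 0 1 1 0) 0 (nu 0 0 1 0) (monomial (nu 0 1 3 0) (1 : K)) =
    monomial (nu 0 1 3 0) (1 : K) := by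
  have h2 : 2 • nu 0 0 1 0 = nu 0 0 2 0 := by ext i; fin_cases i <;> simp
  have h4 : nu 0 0 2 0 + nu 0 1 1 0 = nu 0 1 3 0 := by ext i; fin_cases i <;> simp
  unfold HFlat.pre hasseFamily
  rw [smul_zero, add_zero, h2, hasseDeriv_alpha_val, hasseDeriv_qgamma_val, MvPowerSeries.monomial_mul_monomial, mul_one, h4]

variable (P : ℕ → Ideal (MvPowerSeries (Fin 4) K)) (hg : head K ∈ P 2)

omit [CharP K 2] in
/-- Case (I) «|qγ₀| ≥ 2q» fails (`2 < 4`). [folklore] -/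
theorem not_isCaseI : ¬ IsCaseI (datum K P hg).q (datum K P hg).γ₀ := by
  unfold IsCaseI
  rw [datum_qgamma, datum_q, degree_nu]; omega

omit [CharP K 2] in
/-- Case (II) «|α+pβ| > q» fails (`2 = 2`). [folklore] -/
theorem not_isCaseII : ¬ IsCaseII 2 (datum K P hg).q (datum K P hg).α (datum K P hg).β := by
  unfold IsCaseII
  rw [datum_theta, datum_q, degree_nu]; omega

omit [CharP K 2] in
/-- **Every case witness of the datum is Case (III)** — so EVERY selection policy (printed order, II-first, …) evaluates Rem. 9.11's iterate.
[folklore] -/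
theorem case_eq (c : HFlat.Case 2 (datum K P hg).q (datum K P hg).α (datum K P hg).β (datum K P hg).γ₀) : ∃ h, c = HFlat.Case.III h := by
  rcases c with h | h | h
  · exact absurd h (not_isCaseI K P hg)
  · exact absurd h (not_isCaseII K P hg)
  · exact ⟨h, rfl⟩

omit [CharP K 2] in
/-- In particular the datum's witness is the one every `CaseSelection` (p501470) returns. [folklore] -/
theorem case_eq_sel (sel : CaseSelection 2) :
    (datum K P hg).case = sel (datum K P hg).q (datum K P hg).α (datum K P hg).β (datum K P hg).γ₀ (datum K P hg).lem96 := by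
  obtain ⟨h1, e1⟩ := case_eq K P hg (datum K P hg).case
  obtain ⟨h2, e2⟩ := case_eq K P hg (sel (datum K P hg).q (datum K P hg).α (datum K P hg).β (datum K P hg).γ₀ (datum K P hg).lem96)
  rw [e1, e2]

omit [CharP K 2] in
/-- `b(A,III,0) = |α+pβ+qγ₀| − q = 2` and `k̄ = ⌊q/b⌋ + 1 = 2`. [folklore] -/
theorem kBar_eq : HFlat.kBar (datum K P hg).q (HFlat.bAIII 2 (datum K P hg).q (datum K P hg).α (datum K P hg).β (datum K P hg).γ₀) = 2 := by
  unfold HFlat.kBar HFlat.bAIII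
  rw [datum_exps, degree_nu, datum_q]
  norm_num; rfl

/-- **`H♭(ϵ(0)) = (h♭)²(ϵ(0)) = x z³`.** [folklore] -/
theorem datum_value : (datum K P hg).value = monomial (nu 0 1 3 0) (1 : K) := by
  obtain ⟨hIII, hc⟩ := case_eq K P hg (datum K P hg).case
  unfold HFlatDatum.value
  rw [hc]
  show HFlat.caseIII (hasseFamily K 4) 2 (datum K P hg).q (datum K P hg).α (datum K P hg).β (datum K P hg).γ₀ (eps K) = _
  unfold HFlat.caseIII
  rw [kBar_eq, datum_alpha, datum_beta, datum_gamma, datum_q, Function.iterate_succ_apply, Function.iterate_one, pre_eps, pre_val]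

/-- The value is `x z³ = X 1 * X 2 ^ 3`. [folklore] -/
theorem datum_value' : (datum K P hg).value = X 1 * X 2 ^ 3 := by
  have hexp : Finsupp.single (1 : Fin 4) 1 + Finsupp.single 2 3 = nu 0 1 3 0 := by ext i; fin_cases i <;> simp
  rw [datum_value, MvPowerSeries.X_pow_eq, X_eq_monomial K 1, MvPowerSeries.monomial_mul_monomial, mul_one, hexp]

omit [CharP K 2] in
/-- **`−δ(B,III,0) = q − k̄·b = 2 − 2·2 = −2`.** [folklore] -/
theorem datum_degree : (datum K P hg).degree = -2 := by
  obtain ⟨hIII, hc⟩ := case_eq K P hg (datum K P hg).case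
  unfold HFlatDatum.degree
  rw [hc]
  show HFlat.negDeltaBIII 2 (datum K P hg).q (datum K P hg).α (datum K P hg).β (datum K P hg).γ₀ = -2
  unfold HFlat.negDeltaBIII
  rw [kBar_eq]
  unfold HFlat.bAIII
  rw [datum_exps, degree_nu, datum_q]
  norm_num

omit [CharP K 2] in
/-- The page-degree is negative. [folklore] -/
theorem datum_degree_neg : (datum K P hg).degree < 0 := by rw [datum_degree]; norm_num

/-- Eq. (78), first step: `ϵ(1) = ϵ(0) − H♭(ϵ(0)) = z w³ + x⁷ w` — the top block `x z³` leaves in one step (`u₀ = 1`). [folklore] -/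
theorem eps_sub_value : eps K - (datum K P hg).value = monomial (nu 0 0 1 3) 1 + monomial (nu 0 7 0 1) 1 := by
  rw [datum_value, eps_eq]; abel

/-! ## §2 CELLS at the genuine wild datum: SW ✓ (class regime `e' = 1`, `m = 2`), PW ✗ -/

variable [CharP (MvPowerSeries (Fin 4) K) 2]

/-- **`H♭(ϵ(0)) = x z · z² ∈ ℘nega_sw(e'=1, P, m=2)(−2)` at EVERY placement `P` holding the head in degree `2`**: `Δ_{e_x+e_z}` is a box index
(`< 2`), hence a `ρ`-linear sandwich operator of order `2 ≤ 1·m + a = 4` (`W12.exists_sandwichOp_hasseDeriv_powerSeries`); applied to the live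
source `g ∈ P(1·m)` it gives `z² ∈ ℘nega_sw(−2)` (`W12.apply_mem_sandwichPNega`), and the piece is an ideal. No guard on `P` is used.
NOT a claim that SW meets `F33stdOrd`. [folklore] -/
theorem value_mem_sandwichPNega : (datum K P hg).value ∈ sandwichPNega 2 1 P 2 2 := by
  obtain ⟨D, hD, hDf⟩ := W12.exists_sandwichOp_hasseDeriv_powerSeries K 2 1 (γ := nu 0 1 1 0) (by intro s; fin_cases s <;> simp)
  have hdeg : (nu 0 1 1 0).degree = 2 := by rw [degree_nu]
  rw [hdeg] at hD
  have hmem : D (head K) ∈ sandwichPNega 2 1 P 2 2 :=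
    W12.apply_mem_sandwichPNega 2 1 P 2 2 1 (by norm_num) (by norm_num) (hD.of_le (by norm_num)) (by simpa using hg)
  rw [hDf, head, map_add, hasseDeriv_nu_X0_sq K (by norm_num), zero_add, hasseDeriv_alpha_eps] at hmem
  have h4 : nu 0 1 1 0 + nu 0 0 2 0 = nu 0 1 3 0 := by ext i; fin_cases i <;> simp
  have hval : (datum K P hg).value = monomial (nu 0 1 1 0) (1 : K) * monomial (nu 0 0 2 0) 1 := by
    rw [datum_value, MvPowerSeries.monomial_mul_monomial, mul_one, h4]
  rw [hval]
  exact Ideal.mul_mem_left _ _ hmem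

/-- [read-out] At the Narasimhan datum the `F33stdOrd`/`F33std`/every-selection-SHAPED demand is MET by every family `T` whose degree-`(−2)`
piece at `P` CONTAINS the sandwich piece `℘nega_sw(1, P, 2)(−2)` — in particular by SW itself in the class regime `e' = e`, `m = q`. Contrast:
the cylinder toy of p506668 (✗). [folklore] -/
theorem value_mem_of_sandwich_le (T : ℤ → Set (MvPowerSeries (Fin 4) K))
    (hT : (↑(sandwichPNega 2 1 P 2 2) : Set (MvPowerSeries (Fin 4) K)) ⊆ T (-2)) :
    (datum K P hg).value ∈ T (datum K P hg).degree := by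
  rw [datum_degree]
  exact hT (value_mem_sandwichPNega K P hg)

omit [CharP K 2] [CharP (MvPowerSeries (Fin 4) K) 2] in
/-- `x z³` is not supported on the `2^{e'}`-lattice, `e' ≥ 1` (its `x`-exponent is `1`). [folklore] -/
theorem value_not_isSupportedOnMultiples {e' : ℕ} (he : 1 ≤ e') : ¬ IsSupportedOnMultiples (2 ^ e') (monomial (nu 0 1 3 0) (1 : K)) := by
  classical
  intro h
  have hnd : ¬ 2 ^ e' ∣ nu 0 1 3 0 1 := by
    intro hdvd
    have h2 : (2 : ℕ) ∣ 2 ^ e' := dvd_pow_self 2 (by omega)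
    have h3 : 2 ^ e' ∣ 1 := by simpa using hdvd
    have h4 : (2 : ℕ) ∣ 1 := dvd_trans h2 h3
    omega
  have h1 := h (nu 0 1 3 0) ⟨1, hnd⟩
  rw [MvPowerSeries.coeff_monomial, if_pos rfl] at h1
  exact one_ne_zero h1

/-- **PW fails at the genuine datum too**: `H♭(ϵ(0)) = x z³` is not a `2^{e'}`-th power (`e' ≥ 1`), so it lies in NO negative piece of the
power witness `PW(e', P, m)` (`PowerWitness.tilde_neg_subset_range_pow`, p492701). [folklore] -/
theorem value_not_mem_powerWitness {e' : ℕ} (he : 1 ≤ e') (m : ℕ) :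
    (datum K P hg).value ∉ PowerWitness.tilde 2 e' P m (datum K P hg).degree := by
  rw [datum_degree, datum_value, show (-2 : ℤ) = -((2 : ℕ) : ℤ) by norm_num]
  intro h
  obtain ⟨f, hf⟩ := PowerWitness.tilde_neg_subset_range_pow (p := 2) e' P m 2 (by norm_num) h
  exact value_not_isSupportedOnMultiples K he (Literature.RingTheory.MvPowerSeries.isSupportedOnMultiples_of_exists_pow_eq 2 ⟨f, hf⟩)

end Summit.ResolutionOfSingularities.ResolutionOfSingularities.Theorems.Campaign.PnegaObligation.NarasimhanDatum
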